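import Literature.NumberTheory.GaloisCohomology.Howard2004.TowerMorphismPushforward
import Literature.NumberTheory.GaloisCohomology.Howard2004.SemilinearRingChange
import HarnessLib

/-!
# Howard 2004, Rem. 1.2.4: a morphism of tower settings FROM LEVEL BASE CHANGES — the maps of the
# Kolyvagin quotients `T^{(k)}/I_n → T′^{(k)}/I_n` constructed (not postulated) by descent

Topic `NumberTheory/GaloisCohomology/Howard2004` (sequel to `TowerMorphism`, `TowerMorphismPushforward`,
`SemilinearRingChange`; cell `pub/bsd-print-x9`, seat `bsd-line-x9-p2` g4, STUB A of the shared μ-crux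
— «ONE `Hom` from the `Λ`-adic source into the Eisenstein DVR setting»).  DEFINITIONS WITH BODIES and
theorems; no named fact, no instance, no notation, no `sorry`.

Howard, Rem. 1.2.4 [arXiv:1202.6340 Rem. 2.2.4, p. 7 L13–27] (iii): «if `R → R′` is a ring homomorphism
then there is a map `KS(T,F,𝓛) ⊗_R R′ → KS(T ⊗_R R′, F ⊗_R R′, 𝓛)`»; proof of Thm. 2.2.10, first
sentence [arXiv Thm. 3.2.10, p. 17 L78–81]: «Remark (functoriality) and Lemma (local comparison) yield a
map `KS(𝐓, F_Λ, 𝓛_s(𝐓)) → KS(T_𝔭, F_𝔭, 𝓛_s(T_𝔭))`».  The tree's `CoeffTowerSetting.Hom φ S S′`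
(`TowerMorphism`) records such a morphism as DATA: level maps `f k`, AND maps of the Kolyvagin quotients
`fq k n : T^{(k)}/I_n → T′^{(k)}/I_n` pinned by `fq ∘ π_n = π′_n ∘ f`, equivariant and compatible with
the reductions `rq`.  When every level map `f k : T^{(k)} ↠ T′^{(k)}` PRESENTS THE BASE CHANGE
`T′^{(k)} = T^{(k)} ⊗_{R_k} R′_k` along a surjection of the level rings `φ_k : R_k ↠ R′_k`
(`IsBaseChangeBy`, `SemilinearRingChange` §2 — the situation of the Eisenstein specialisation
`Λ/(ω_σ, p^σ) ↠ Λ/(q_m, p^{k+1})` of the reindexed Shapiro-diagonal source), the quotient half of the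
`Hom` is FORCED: `φ_k (I_n(R_k, T^{(k)})) ⊆ I_n(R′_k, T′^{(k)})` always (`IsBaseChangeBy.map_levelIdeal_le`),
so `f k` descends to the Kolyvagin quotients under ANY two presentations (`IsQuotientBy.descend`), and
the descended maps are automatically pinned, equivariant, `φ_k`-semilinear and compatible with `rq`
(from `rq_comp` on both sides and `f_red`).  This file:

* `CoeffTowerSetting.fqOfBaseChange S S′ f φk hbc k n : Nq k n →+ Nq′ k n` — THE map
  `T^{(k)}/I_n → T′^{(k)}/I_n` over `f k` (descent), with `fqOfBaseChange_comp` (`fq ∘ π_n = π′_n ∘ f`),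
  `_equivariant`, `_smul` (`φ_k`-semilinear), `_surjective`, `_unique`, **`fqOfBaseChange_rq`**
  (compatibility with the reductions of the Kolyvagin quotients, from `f_red`);
* **`CoeffTowerSetting.Hom.ofBaseChange`** — the constructor of `Hom φ S S′` from `(f, φk, hbc)`, the
  global semilinearity `f_smul` over `φ : R → R′`, `f_red`, and the four genuinely setting-dependent
  inputs `jbar_eq`, `primes_subset` ((i) `𝓛′ ⊆ 𝓛`), `cond_le` ((ii)+(iii) `F ⊗ R′ ≤ F′`, Lemma 2.2.7) and
  `fs_compat` (naturality of `φ^{fs}` across the change, stated for the descended maps);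
  unfolding lemmas `ofBaseChange_f`, `ofBaseChange_fq`, `ofBaseChange_fH1`, `ofBaseChange_fqH1_apply`,
  and the bottom class of the pushforward along it (`pushforward_ofBaseChange_one`).
BSD is not proved by any of this.
[cite: Howard2004HeegnerKolyvagin, Rem. 1.2.4 (arXiv Rem. 2.2.4, p. 7, L13–27); Def. 1.2.3 (arXiv p. 7, L1–12); proof of Thm. 2.2.10 (arXiv p. 17, L78–81)]
-/

set_option autoImplicit false

noncomputable section

open Function NumberField IsDedekindDomain Field CategoryTheory
open scoped NumberField ContRepresentation Classical TensorProduct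

namespace Literature.NumberTheory.GaloisCohomology.Howard2004

open Literature.NumberTheory.GaloisRepresentations
open Literature.NumberTheory.GaloisRepresentations.DiscreteGaloisModule

section BaseChange

variable {p : ℕ} [Fact p.Prime] {K : Type} [Field K] [NumberField K]
  {R : Type} [CommRing R] [IsLocalRing R] [Algebra ℤ_[p] R]
  {N : ℕ → Type} [∀ k, AddCommGroup (N k)] [∀ k, TopologicalSpace (N k)]
  [∀ k, DiscreteTopology (N k)] [∀ k, Module R (N k)]
  {Rk : ℕ → Type} [∀ k, CommRing (Rk k)] [∀ k, IsLocalRing (Rk k)] [∀ k, TopologicalSpace (Rk k)]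
  [∀ k, DiscreteTopology (Rk k)] [∀ k, Algebra ℤ_[p] (Rk k)] [∀ k, Algebra R (Rk k)]
  [∀ k, Module (Rk k) (N k)] [∀ k, IsScalarTower R (Rk k) (N k)]
  {Nbar : Type} [AddCommGroup Nbar] [TopologicalSpace Nbar] [DiscreteTopology Nbar]
  [∀ k, Module (Rk k) Nbar]
  {Nq : ℕ → Finset (HeightOneSpectrum (𝓞 K)) → Type} [∀ k n, AddCommGroup (Nq k n)]
  [∀ k n, TopologicalSpace (Nq k n)] [∀ k n, DiscreteTopology (Nq k n)]
  [∀ k n, Module (Rk k) (Nq k n)] [∀ k n, Module R (Nq k n)]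
  [∀ k n, IsScalarTower R (Rk k) (Nq k n)]
  {R' : Type} [CommRing R'] [IsLocalRing R'] [Algebra ℤ_[p] R']
  {N' : ℕ → Type} [∀ k, AddCommGroup (N' k)] [∀ k, TopologicalSpace (N' k)]
  [∀ k, DiscreteTopology (N' k)] [∀ k, Module R' (N' k)]
  {Rk' : ℕ → Type} [∀ k, CommRing (Rk' k)] [∀ k, IsLocalRing (Rk' k)] [∀ k, TopologicalSpace (Rk' k)]
  [∀ k, DiscreteTopology (Rk' k)] [∀ k, Algebra ℤ_[p] (Rk' k)] [∀ k, Algebra R' (Rk' k)]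
  [∀ k, Module (Rk' k) (N' k)] [∀ k, IsScalarTower R' (Rk' k) (N' k)]
  {Nbar' : Type} [AddCommGroup Nbar'] [TopologicalSpace Nbar'] [DiscreteTopology Nbar']
  [∀ k, Module (Rk' k) Nbar']
  {Nq' : ℕ → Finset (HeightOneSpectrum (𝓞 K)) → Type} [∀ k n, AddCommGroup (Nq' k n)]
  [∀ k n, TopologicalSpace (Nq' k n)] [∀ k n, DiscreteTopology (Nq' k n)]
  [∀ k n, Module (Rk' k) (Nq' k n)] [∀ k n, Module R' (Nq' k n)]
  [∀ k n, IsScalarTower R' (Rk' k) (Nq' k n)]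

namespace CoeffTowerSetting

variable (S : CoeffTowerSetting p K R N Rk Nbar Nq) (S' : CoeffTowerSetting p K R' N' Rk' Nbar' Nq')
  (f : ∀ k, N k →+ N' k) (φk : ∀ k, Rk k →+* Rk' k)
  (hbc : ∀ k, IsBaseChangeBy (S.T.ρ k) (φk k) (S'.T.ρ k) (f k))

/-! ## The maps of the Kolyvagin quotients over level base changes -/

/-- **THE map `T^{(k)}/I_n → T′^{(k)}/I_n` over a level base change `f k : T^{(k)} ↠ T′^{(k)} = T^{(k)} ⊗ R′_k`**,
under the presentations of the two settings (descent of `f k`: it carries `I_n(R_k,T^{(k)})•T^{(k)}` into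
`I_n(R′_k,T′^{(k)})•T′^{(k)}`, `IsBaseChangeBy.mapsTo_levelIdeal_smul_top`).
[cite: Howard2004HeegnerKolyvagin, Def. 1.2.3 and Rem. 1.2.4 (arXiv p. 7, L1–27)] -/
def fqOfBaseChange (k : ℕ) (n : Finset (HeightOneSpectrum (𝓞 K))) : Nq k n →+ Nq' k n :=
  ((S.LD k).isQuotientBy n).descend ((S'.LD k).isQuotientBy n) (f k) ((hbc k).mapsTo_levelIdeal_smul_top n)

/-- `fq ∘ π_n = π′_n ∘ f` (the pin `Hom.fq_comp`). [cite: Howard2004HeegnerKolyvagin, Rem. 1.2.4 (arXiv p. 7, L13–27)] -/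
theorem fqOfBaseChange_comp (k : ℕ) (n : Finset (HeightOneSpectrum (𝓞 K))) (x : N k) :
    S.fqOfBaseChange S' f φk hbc k n ((S.LD k).π n x) = (S'.LD k).π n (f k x) :=
  IsQuotientBy.descend_apply _ _ _ _ x

/-- `fq` is `Γ_K`-equivariant (the field `Hom.fq_equivariant`). [cite: Howard2004HeegnerKolyvagin, Rem. 1.2.4 (arXiv p. 7, L13–27)] -/
theorem fqOfBaseChange_equivariant (k : ℕ) (n : Finset (HeightOneSpectrum (𝓞 K)))
    (σ : absoluteGaloisGroup K) (y : Nq k n) :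
    S.fqOfBaseChange S' f φk hbc k n ((S.LD k).ρq n σ y) =
      (S'.LD k).ρq n σ (S.fqOfBaseChange S' f φk hbc k n y) :=
  IsQuotientBy.descend_equivariant _ _ _ _ (hbc k).equivariant σ y

/-- `fq` is `φ_k`-semilinear over the level rings. [cite: Howard2004HeegnerKolyvagin, Rem. 1.2.4 (iii) (arXiv p. 7, L19–27)] -/
theorem fqOfBaseChange_smul (k : ℕ) (n : Finset (HeightOneSpectrum (𝓞 K))) (r : Rk k) (y : Nq k n) :
    S.fqOfBaseChange S' f φk hbc k n (r • y) = φk k r • S.fqOfBaseChange S' f φk hbc k n y :=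
  IsQuotientBy.descend_smul _ _ _ _ (hbc k).map_smul r y

/-- `fq` is surjective (both `f k` and `π′_n` are). [cite: Howard2004HeegnerKolyvagin, Rem. 1.2.4 (arXiv p. 7, L13–27)] -/
theorem fqOfBaseChange_surjective (k : ℕ) (n : Finset (HeightOneSpectrum (𝓞 K))) :
    Function.Surjective (S.fqOfBaseChange S' f φk hbc k n) :=
  (hbc k).descend_surjective _ _ _

/-- **Uniqueness**: any additive map under the two presentations over `f k` is `fqOfBaseChange`.
[cite: Howard2004HeegnerKolyvagin, Def. 1.1.3 (arXiv Def. 2.1.3, p. 5, L95–97)] -/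
theorem fqOfBaseChange_unique (k : ℕ) (n : Finset (HeightOneSpectrum (𝓞 K))) {g : Nq k n →+ Nq' k n}
    (hg : ∀ x : N k, g ((S.LD k).π n x) = (S'.LD k).π n (f k x)) :
    g = S.fqOfBaseChange S' f φk hbc k n :=
  IsQuotientBy.descend_unique _ _ _ _ hg

/-- **`fq` is compatible with the reductions of the Kolyvagin quotients** (`Hom.fq_rq`):
`fq_k ∘ rq_k = rq′_k ∘ fq_{k+1}`, from `rq ∘ π = π ∘ red` on both sides and `f_k ∘ red_k = red′_k ∘ f_{k+1}`.
[cite: Howard2004HeegnerKolyvagin, Def. 1.2.3 / §1.6 (arXiv p. 7 L1–12, p. 11 L49–50)] -/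
theorem fqOfBaseChange_rq (hred : ∀ k (x : N (k + 1)), f k (S.T.red k x) = S'.T.red k (f (k + 1) x))
    (k : ℕ) (n : Finset (HeightOneSpectrum (𝓞 K))) (y : Nq (k + 1) n) :
    S.fqOfBaseChange S' f φk hbc k n (S.rq k n y) =
      S'.rq k n (S.fqOfBaseChange S' f φk hbc (k + 1) n y) := by
  obtain ⟨x, rfl⟩ := ((S.LD (k + 1)).isQuotientBy n).surjective y
  rw [S.rq_comp, fqOfBaseChange_comp, hred, fqOfBaseChange_comp, S'.rq_comp]

/-- `H¹(K, fq)` under the two presentations: `H¹(fq) ∘ H¹(π_n) = H¹(π′_n) ∘ H¹(f)`.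
[cite: Howard2004HeegnerKolyvagin, Rem. 1.2.4 (iii) (arXiv p. 7, L19–27)] -/
theorem cohomologyMap_fqOfBaseChange_cohomologyMap (k : ℕ) (n : Finset (HeightOneSpectrum (𝓞 K)))
    (c : galoisCohomology (S.T.ρ k) 1) :
    ContinuousRep.cohomologyMap ((S.LD k).ρq n) ((S'.LD k).ρq n) (S.fqOfBaseChange S' f φk hbc k n)
        continuous_of_discreteTopology (S.fqOfBaseChange_equivariant S' f φk hbc k n) 1
        (((S.LD k).isQuotientBy n).cohomologyMap 1 c) =
      ((S'.LD k).isQuotientBy n).cohomologyMap 1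
        (ContinuousRep.cohomologyMap (S.T.ρ k) (S'.T.ρ k) (f k) continuous_of_discreteTopology
          (hbc k).equivariant 1 c) :=
  cohomologyMap_one_comm_sq _ _ _ _ _ _ _ _ _ _ _ _ (fun x => S.fqOfBaseChange_comp S' f φk hbc k n x) c

/-! ## The constructor -/

variable {φ : R →+* R'}

/-- **A morphism of tower settings from level base changes** (Rem. 1.2.4 (iii) realised): given level maps
`f k` presenting `T′^{(k)} = T^{(k)} ⊗_{R_k} R′_k` along surjections `φ_k` of the level rings (`hbc`),
`φ`-semilinear for the global ring map and compatible with the reductions, the quotient maps of the `Hom`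
are `fqOfBaseChange` (pinned, equivariant, `rq`-compatible by the lemmas above); the remaining inputs are
the same `jbar`, `𝓛′ ⊆ 𝓛`, the local comparison `F ⊗ R′ ≤ F′` (Lemma 2.2.7) and the naturality of the
finite–singular maps across the change (stated for the descended maps).
[cite: Howard2004HeegnerKolyvagin, Rem. 1.2.4 (arXiv Rem. 2.2.4, p. 7, L13–27) and Lemma 2.2.7 (arXiv p. 16, L142–148)] -/
def Hom.ofBaseChange (hsmul : ∀ k (r : R) (x : N k), f k (r • x) = φ r • f k x)
    (hred : ∀ k (x : N (k + 1)), f k (S.T.red k x) = S'.T.red k (f (k + 1) x))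
    (hjbar : S'.jbar = S.jbar) (hprimes : S'.L ⊆ S.L)
    (hcond : ∀ k (v : Place K), ((S.t k).cond v).map
      (ContinuousRep.cohomologyMap ((S.T.ρ k).toLocal v) ((S'.T.ρ k).toLocal v) (f k)
        continuous_of_discreteTopology (fun _ x => (hbc k).equivariant _ x) 1) ≤ (S'.t k).cond v)
    (hfs : ∀ k n (v : HeightOneSpectrum (𝓞 K)),
      ∀ c ∈ unramifiedSubgroup (GaloisRep.toLocal v ((S.LD k).ρq n)) 1,
        (S'.LD k).fs n v (localH1Map ((S.LD k).ρq n) ((S'.LD k).ρq n) v (S.fqOfBaseChange S' f φk hbc k n)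
            (fun _ y => S.fqOfBaseChange_equivariant S' f φk hbc k n _ y) c) =
          TensorProduct.map (singularQuotientMap ((S.LD k).ρq n) ((S'.LD k).ρq n) v
              (S.fqOfBaseChange S' f φk hbc k n)
              (fun _ y => S.fqOfBaseChange_equivariant S' f φk hbc k n _ y)).toIntLinearMap LinearMap.id
            ((S.LD k).fs n v c)) :
    Hom φ S S' where
  f := f
  f_smul := hsmul
  f_equivariant k σ x := (hbc k).equivariant σ x
  f_red := hred
  fq := S.fqOfBaseChange S' f φk hbc
  fq_comp k n x := S.fqOfBaseChange_comp S' f φk hbc k n x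
  fq_equivariant k n σ y := S.fqOfBaseChange_equivariant S' f φk hbc k n σ y
  fq_rq k n y := S.fqOfBaseChange_rq S' f φk hbc hred k n y
  jbar_eq := hjbar
  primes_subset := hprimes
  cond_le := hcond
  fs_compat := hfs

section Unfold

variable (hsmul : ∀ k (r : R) (x : N k), f k (r • x) = φ r • f k x)
  (hred : ∀ k (x : N (k + 1)), f k (S.T.red k x) = S'.T.red k (f (k + 1) x))
  (hjbar : S'.jbar = S.jbar) (hprimes : S'.L ⊆ S.L)
  (hcond : ∀ k (v : Place K), ((S.t k).cond v).map
    (ContinuousRep.cohomologyMap ((S.T.ρ k).toLocal v) ((S'.T.ρ k).toLocal v) (f k)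
      continuous_of_discreteTopology (fun _ x => (hbc k).equivariant _ x) 1) ≤ (S'.t k).cond v)
  (hfs : ∀ k n (v : HeightOneSpectrum (𝓞 K)),
    ∀ c ∈ unramifiedSubgroup (GaloisRep.toLocal v ((S.LD k).ρq n)) 1,
      (S'.LD k).fs n v (localH1Map ((S.LD k).ρq n) ((S'.LD k).ρq n) v (S.fqOfBaseChange S' f φk hbc k n)
          (fun _ y => S.fqOfBaseChange_equivariant S' f φk hbc k n _ y) c) =
        TensorProduct.map (singularQuotientMap ((S.LD k).ρq n) ((S'.LD k).ρq n) v
            (S.fqOfBaseChange S' f φk hbc k n)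
            (fun _ y => S.fqOfBaseChange_equivariant S' f φk hbc k n _ y)).toIntLinearMap LinearMap.id
          ((S.LD k).fs n v c))

/-- Unfolding: the level maps of `Hom.ofBaseChange` are `f`. [cite: Howard2004HeegnerKolyvagin, Rem. 1.2.4 (arXiv p. 7, L13–27)] -/
@[simp] theorem Hom.ofBaseChange_f :
    (Hom.ofBaseChange S S' f φk hbc hsmul hred hjbar hprimes hcond hfs).f = f := rfl

/-- Unfolding: the quotient maps of `Hom.ofBaseChange` are `fqOfBaseChange`. [cite: Howard2004HeegnerKolyvagin, Rem. 1.2.4 (arXiv p. 7, L13–27)] -/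
@[simp] theorem Hom.ofBaseChange_fq :
    (Hom.ofBaseChange S S' f φk hbc hsmul hred hjbar hprimes hcond hfs).fq = S.fqOfBaseChange S' f φk hbc := rfl

/-- Unfolding: `fH1` of `Hom.ofBaseChange` is `H¹(K, f k)`. [cite: Howard2004HeegnerKolyvagin, Rem. 1.2.4 (iii) (arXiv p. 7, L19–27)] -/
theorem Hom.ofBaseChange_fH1 (k : ℕ) :
    (Hom.ofBaseChange S S' f φk hbc hsmul hred hjbar hprimes hcond hfs).fH1 k =
      ContinuousRep.cohomologyMap (S.T.ρ k) (S'.T.ρ k) (f k) continuous_of_discreteTopology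
        (hbc k).equivariant 1 := rfl

/-- Unfolding: `fH1Loc` of `Hom.ofBaseChange` is `H¹(K_v, f k)`. [cite: Howard2004HeegnerKolyvagin, Rem. 1.2.4 (iii) (arXiv p. 7, L19–27)] -/
theorem Hom.ofBaseChange_fH1Loc (k : ℕ) (v : Place K) :
    (Hom.ofBaseChange S S' f φk hbc hsmul hred hjbar hprimes hcond hfs).fH1Loc k v =
      ContinuousRep.cohomologyMap ((S.T.ρ k).toLocal v) ((S'.T.ρ k).toLocal v) (f k)
        continuous_of_discreteTopology (fun _ x => (hbc k).equivariant _ x) 1 := rfl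

/-- Unfolding: `fqH1` of `Hom.ofBaseChange` is `H¹(K, fqOfBaseChange k n)`. [cite: Howard2004HeegnerKolyvagin, Rem. 1.2.4 (iii) (arXiv p. 7, L19–27)] -/
theorem Hom.ofBaseChange_fqH1 (k : ℕ) (n : Finset (HeightOneSpectrum (𝓞 K))) :
    (Hom.ofBaseChange S S' f φk hbc hsmul hred hjbar hprimes hcond hfs).fqH1 k n =
      ContinuousRep.cohomologyMap ((S.LD k).ρq n) ((S'.LD k).ρq n) (S.fqOfBaseChange S' f φk hbc k n)
        continuous_of_discreteTopology (S.fqOfBaseChange_equivariant S' f φk hbc k n) 1 := rfl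

/-- **The bottom class of the pushforward along `Hom.ofBaseChange` is `H¹(f k) κ_1` levelwise.**
[cite: Howard2004HeegnerKolyvagin, Rem. 1.2.4 and proof of Thm. 2.2.10 (arXiv p. 7 L13–27, p. 17 L78–81)] -/
theorem Hom.pushforward_ofBaseChange_one (hL : ∀ k, (S.t k).primes = S.L) (hL' : ∀ k, (S'.t k).primes = S'.L)
    (κ : S.KolyvaginSystem) (k : ℕ) :
    ((Hom.ofBaseChange S S' f φk hbc hsmul hred hjbar hprimes hcond hfs).pushforward hL hL' κ).one k =
      ContinuousRep.cohomologyMap (S.T.ρ k) (S'.T.ρ k) (f k) continuous_of_discreteTopology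
        (hbc k).equivariant 1 (κ.one k) := rfl

end Unfold

end CoeffTowerSetting

end BaseChange

end Literature.NumberTheory.GaloisCohomology.Howard2004

end
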